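import Literature.MathematicalPhysics.QuantumFieldTheory.Balaban1983to89.B1Eq324BenfattoSect5Termination
import Literature.MathematicalPhysics.QuantumFieldTheory.Balaban1983to89.B1Eq324BenfattoKernelAppendixA
import Literature.MathematicalPhysics.QuantumFieldTheory.Balaban1983to89.B1Eq324BenfattoKernelOfPrecision
import HarnessLib

/-!
# `Balaban1983to89.B1Eq324BenfattoKernelSect5Termination` — [BenfattoEtAl1978] §5 p. 154 / p. 159, THE END OF THE ITERATION for the CLASS of
# [Balaban1985BackgroundPropagators] Sect. E p. 428: the trivial case `H_J = 0` is the small-field volume of the Gaussian field of ANY kernel, and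
# Appendix A bounds it from below with constants depending on the coercivity constant of the class ONLY — PROVED (the class edition of
# `…Sect5Termination` §1; its §2 termination geometry and §3 chaining are kernel-free and are cited, not restated)

statement-level skeleton of published theorems with citation tags; proofs where landed; nothing here is a claim about the
Yang–Mills mass gap

WHY THIS MODULE (cell `pub-ymgap`, width seat `dag-n08-w5`; row S6 «`KernelSect5Termination` (width seat)» of seat n08-d gen 13's located map
`N08-PORT-MAP-STRUCTURAL-SIDE.md` §1/§3; node N08 [Balaban1985UV3]; the [BenfattoEtAl1978] source chain behind the (α)-row `h324`).  Print, p. 154: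
*"After (d+1) steps one can obviously manage by suitably choosing the successive displaced pavements so that (J∩Γ₁)∩Γ₂∩…∩Γ_{d+1} = ∅ thereby
reducing the proof of the lemma to the trivial case H_J = 0."*  The concrete module `…Sect5Termination` types the three facts the iteration needs
at the free field `P̂₀`: §1 the terminal integral is the small-field volume and Appendix A bounds it from below, §2 no site survives `d + 1` suitably
displaced corridor networks, §3 the step inequalities chain.  §2 and §3 never mention the measure.  §1 does, and for T. Bałaban's data the measure is
the Gaussian field of a CLASS kernel (seat n08-d's `…KernelOfPrecision`: `K = ` the zero extension of `A⁻¹` for a symmetric `γ_A`-coercive precision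
`A` on a finite `Λ`); seat n08-c's `…KernelAppendixA` already proves (A.1)–(A.2) for the Gaussian field of every positive-semidefinite kernel with
bounded diagonal, constants uniform in the bound.  This file is the class edition of §1: the trivial case for ANY measure, Appendix A for any such
kernel (three currencies: uniform `∃ b̄ k₁ k₂`, explicit, translated), and — the form the class chain consumes — for the class in precision form with
constants depending on `(d, γ_A)` ONLY (`K(x,x) ≤ 1/γ_A`, J1 `kernel_self_le`), hence uniform over `Λ`, over the pavement, over the displaced
pavements and over a renormalisation induction.

WHAT IS PROVED (standard axioms; no `sorry`; no definition).
* §1 `integral_cutoffBoltzmann_empty_measure` — THE TRIVIAL CASE for ANY measure `μ` on `Q₀ → ℝ`: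
  `∫ cutoffBoltzmann (hamiltonian s D ϰ a ∅) I c dμ = μ.real (smallFieldSet I c)` (the concrete `…Sect5Termination.integral_cutoffBoltzmann_empty` is
  the instance `μ = P̂₀`).
* §2 ANY KERNEL: ★ `exists_integral_cutoffBoltzmann_empty_ge_of_kernel` (`K` psd, `K(x,x) ≤ g₀` ⇒ `∃ b̄ k₁ k₂`, `0 ≤ k₁`, `0 < k₂`, depending on
  `(d, g₀)` only and serving EVERY such `K`: `exp(−|I|·k₁e^{−k₂c²}) ≤ ∫ cutoffBoltzmann (hamiltonian s D ϰ a ∅) I c dμ_K` for `c > b̄`, `I ≠ ∅`),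
  `integral_cutoffBoltzmann_empty_ge_of_kernel` (explicit `k₁ = 4·8^d`, `k₂ = 1/(2C)` for `c > 0`, `c² ≥ 4C`),
  `integral_cutoffBoltzmann_empty_ge_of_kernel_translate` (the same constants for every translate `K(·+σ,·+σ)` — displaced pavements cost nothing).
* §3 THE CLASS IN PRECISION FORM (J1's `hK` row, `A` symmetric `γ_A`-coercive): `kernel_self_le_inv` (`K(x,x) ≤ 1/γ_A`, J1 BY NAME),
  ★★ `integral_cutoffBoltzmann_empty_ge_of_class` (explicit: `exp(−|I|·(4·8^d)·e^{−γ_A c²/2}) ≤ ∫ cutoffBoltzmann (hamiltonian s D ϰ a ∅) I c dμ_K`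
  for `c > 0`, `c² ≥ 4/γ_A`) and ★★ `exists_integral_cutoffBoltzmann_empty_ge_of_class` (`∃ b̄ k₁ k₂` depending on `(d, γ_A)` ONLY, serving every
  `Λ`, every symmetric `γ_A`-coercive `A` and its class kernel).
HONEST SCOPE.  Assembly by name over seat n08-c's kernel-generic Appendix A and seat n08-d's class kernel facts; nothing of [Balaban1985UV3] /
[Balaban1985UV2] is asserted; no generalised Basic Lemma is stated; the §5-side port is not commissioned and not begun here (a located,
definition-free piece of its termination step); count-neutral for N08; nothing about d = 4, the continuum, OS axioms, a mass gap or the Clay problem.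
-/

noncomputable section

open MeasureTheory Finset Matrix
open scoped BigOperators

namespace Literature.MathematicalPhysics.QuantumFieldTheory.Balaban1983to89.B1Eq324BenfattoKernelSect5Termination

open _root_.MeasureTheory
open Literature.MathematicalPhysics.QuantumFieldTheory
open Literature.MathematicalPhysics.QuantumFieldTheory.Balaban1983to89.B1Eq324BenfattoLemma
open Literature.MathematicalPhysics.QuantumFieldTheory.Balaban1983to89.B1Eq324BenfattoSect5Termination (hamiltonian_empty)
open Literature.MathematicalPhysics.QuantumFieldTheory.Balaban1983to89.B1Eq324BenfattoKernelAppendixA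
open Literature.MathematicalPhysics.QuantumFieldTheory.Balaban1983to89.B1Eq324BenfattoKernelOfPrecision
open Literature.MathematicalPhysics.QuantumFieldTheory.Balaban1983to89.B1Eq324BenfattoClassAppendixC (posDef_of_coercive)

variable {d : ℕ}

/-! ## §1  The trivial case `H_J = 0` for any measure -/

section Trivial

variable {s D : ℕ} {κ : ℝ}

/-- **THE TERMINAL INTEGRAL IS THE SMALL-FIELD VOLUME, for ANY measure**: `∫ cutoffBoltzmann (hamiltonian s D ϰ a ∅) I c dμ = μ(Π_Δ χ̂^c_Δ)`
(«the trivial case H_J = 0», p. 154; `H^A_∅ = 0` is `…Sect5Termination.hamiltonian_empty`).  The free-field statement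
`…Sect5Termination.integral_cutoffBoltzmann_empty` is the instance `μ = P̂₀`. [cite: BenfattoEtAl1978, §5 p.154; Appendix A (A.1) p.161] -/
theorem integral_cutoffBoltzmann_empty_measure (μ : Measure (B1Eq324BenfattoLemma.Site d → ℝ)) (a : Coef d)
    (I : Finset (B1Eq324BenfattoLemma.Site d)) (c : ℝ) :
    ∫ z, cutoffBoltzmann (hamiltonian s D κ a (∅ : Finset (B1Eq324BenfattoLemma.Site d))) I c z ∂μ = μ.real (smallFieldSet I c) := by
  have h : (cutoffBoltzmann (hamiltonian s D κ a (∅ : Finset (B1Eq324BenfattoLemma.Site d))) I c) =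
      (smallFieldSet I c).indicator (fun _ => (1 : ℝ)) := by
    funext z
    simp only [cutoffBoltzmann, hamiltonian_empty, Real.exp_zero]
  rw [h]
  exact integral_indicator_one (measurableSet_smallFieldSet I c)

end Trivial

/-! ## §2  Appendix A bounds the terminal integral from below: the Gaussian field of any kernel with bounded diagonal -/

section AnyKernel

variable {s D : ℕ} {κ : ℝ}

/-- **APPENDIX A FOR THE TERMINAL INTEGRAL, any kernel, UNIFORM constants**: for every `g₀` there are `b̄, k₁ ≥ 0, k₂ > 0` depending on `(d, g₀)`
only such that for EVERY positive-semidefinite kernel `K` on `Q₀` with `K(x,x) ≤ g₀`, every `c > b̄` and every nonempty `I`,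
`exp(−|I|·k₁e^{−k₂c²}) ≤ ∫ cutoffBoltzmann (hamiltonian s D ϰ a ∅) I c dμ_K` — seat n08-c's `…KernelAppendixA.appendixA_uniform_of_diag_le` read
through §1.  The free-field statement is `…Sect5Termination.exists_integral_cutoffBoltzmann_empty_ge`. [cite: BenfattoEtAl1978, Appendix A (A.1)–(A.2) p.161; §5 p.154, p.159] -/
theorem exists_integral_cutoffBoltzmann_empty_ge_of_kernel (d : ℕ) (g₀ : ℝ) :
    ∃ bbar k₁ k₂ : ℝ, 0 ≤ k₁ ∧ 0 < k₂ ∧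
      ∀ {K : B1Eq324BenfattoLemma.Site d → B1Eq324BenfattoLemma.Site d → ℝ}, IsPosSemidefKernel K → (∀ x, K x x ≤ g₀) →
        ∀ {s D : ℕ} {κ : ℝ} (a : Coef d) (c : ℝ), bbar < c → ∀ I : Finset (B1Eq324BenfattoLemma.Site d), I.Nonempty →
          Real.exp (-((I.card : ℝ) * (k₁ * Real.exp (-(k₂ * c ^ 2))))) ≤
            ∫ z, cutoffBoltzmann (hamiltonian s D κ a (∅ : Finset (B1Eq324BenfattoLemma.Site d))) I c z ∂gaussianFieldOfKernel K := by
  obtain ⟨bbar, k₁, k₂, hk₁, hk₂, h⟩ := appendixA_uniform_of_diag_le d g₀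
  refine ⟨bbar, k₁, k₂, hk₁, hk₂, fun hK hKg _ _ _ a c hc I hI => ?_⟩
  rw [integral_cutoffBoltzmann_empty_measure]
  exact h hK hKg c hc I hI

/-- **Appendix A for the terminal integral, any kernel, EXPLICIT constants**: `K` psd with `K(x,x) ≤ C` (`C > 0`), `c > 0`, `c² ≥ 4C`, `I ≠ ∅` ⇒
`exp(−|I|·(4·8^d)·e^{−c²/(2C)}) ≤ ∫ cutoffBoltzmann (hamiltonian s D ϰ a ∅) I c dμ_K` (`…KernelAppendixA.appendixA_explicit_of_kernel` through §1).
[cite: BenfattoEtAl1978, Appendix A (A.1)–(A.2) p.161; §5 p.154] -/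
theorem integral_cutoffBoltzmann_empty_ge_of_kernel {K : B1Eq324BenfattoLemma.Site d → B1Eq324BenfattoLemma.Site d → ℝ}
    (hK : IsPosSemidefKernel K) {C : ℝ} (hC : 0 < C) (hKC : ∀ x, K x x ≤ C) {c : ℝ} (hc0 : 0 < c) (hc : 4 * C ≤ c ^ 2)
    (a : Coef d) {I : Finset (B1Eq324BenfattoLemma.Site d)} (hI : I.Nonempty) :
    Real.exp (-((I.card : ℝ) * (4 * 8 ^ d * Real.exp (-(c ^ 2 / (2 * C)))))) ≤
      ∫ z, cutoffBoltzmann (hamiltonian s D κ a (∅ : Finset (B1Eq324BenfattoLemma.Site d))) I c z ∂gaussianFieldOfKernel K := by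
  rw [integral_cutoffBoltzmann_empty_measure]
  exact appendixA_explicit_of_kernel hK hC hKC hc0 hc hI

/-- **Displaced pavements cost nothing at the Appendix A input**: the same explicit bound for every lattice translate `K(· + σ, · + σ)` of such a
kernel (`…KernelAppendixA.appendixA_explicit_of_kernel_translate` through §1). [cite: BenfattoEtAl1978, Appendix A (A.1)–(A.2) p.161; §5 p.159] -/
theorem integral_cutoffBoltzmann_empty_ge_of_kernel_translate {K : B1Eq324BenfattoLemma.Site d → B1Eq324BenfattoLemma.Site d → ℝ}
    (hK : IsPosSemidefKernel K) {C : ℝ} (hC : 0 < C) (hKC : ∀ x, K x x ≤ C) {c : ℝ} (hc0 : 0 < c) (hc : 4 * C ≤ c ^ 2)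
    (a : Coef d) {I : Finset (B1Eq324BenfattoLemma.Site d)} (hI : I.Nonempty) (σ : B1Eq324BenfattoLemma.Site d) :
    Real.exp (-((I.card : ℝ) * (4 * 8 ^ d * Real.exp (-(c ^ 2 / (2 * C)))))) ≤
      ∫ z, cutoffBoltzmann (hamiltonian s D κ a (∅ : Finset (B1Eq324BenfattoLemma.Site d))) I c z
        ∂gaussianFieldOfKernel (fun x y => K (x + σ) (y + σ)) := by
  rw [integral_cutoffBoltzmann_empty_measure]
  exact appendixA_explicit_of_kernel_translate hK hC hKC hc0 hc hI σ

end AnyKernel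

/-! ## §3  The class in precision form: constants depending on `(d, γ_A)` only -/

section ClassKernel

variable {s D : ℕ} {κ : ℝ}
  {Λ : Finset (B1Eq324BenfattoLemma.Site d)} {A : Matrix Λ Λ ℝ}
  {K : B1Eq324BenfattoLemma.Site d → B1Eq324BenfattoLemma.Site d → ℝ}
  (hK : ∀ x y, K x y = if h : x ∈ Λ ∧ y ∈ Λ then (A⁻¹ : Matrix Λ Λ ℝ) ⟨x, h.1⟩ ⟨y, h.2⟩ else 0)

include hK

/-- **The diagonal of the class kernel is bounded by the inverse coercivity constant**: `K(x,x) ≤ 1/γ_A` for every `x ∈ Q₀` (J1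
`…KernelOfPrecision.kernel_self_le`; off `Λ` the kernel vanishes). [cite: BenfattoEtAl1978, Appendix C (C.4) p.164 (class form); Balaban1985BackgroundPropagators, Sect. E p.428] -/
theorem kernel_self_le_inv (hAs : ∀ e e', A e e' = A e' e) {γA : ℝ} (hγA0 : 0 < γA)
    (hγA : ∀ v : Λ → ℝ, γA * ∑ e, v e ^ 2 ≤ ∑ e, ∑ e', A e e' * v e * v e') (x : B1Eq324BenfattoLemma.Site d) :
    K x x ≤ 1 / γA :=
  (kernel_self_le hK hAs hγA0 hγA x).2

/-- **APPENDIX A FOR THE TERMINAL INTEGRAL OF THE CLASS, explicit**: for the class kernel `K` of a symmetric `γ_A`-coercive precision `A` on `Λ`,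
every `c > 0` with `c² ≥ 4/γ_A` and every nonempty `I`:
`exp(−|I|·(4·8^d)·e^{−c²/(2/γ_A)}) ≤ ∫ cutoffBoltzmann (hamiltonian s D ϰ a ∅) I c dμ_K` — constants in `(d, γ_A)` ONLY (uniform in `Λ`, in the pavement
and its displacements, and along a renormalisation induction whose coercivity constant is `k`-independent).
[cite: BenfattoEtAl1978, Appendix A (A.1)–(A.2) p.161; §5 p.154, p.159; Balaban1985BackgroundPropagators, Sect. E p.428] -/
theorem integral_cutoffBoltzmann_empty_ge_of_class (hAs : ∀ e e', A e e' = A e' e) {γA : ℝ} (hγA0 : 0 < γA)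
    (hγA : ∀ v : Λ → ℝ, γA * ∑ e, v e ^ 2 ≤ ∑ e, ∑ e', A e e' * v e * v e') {c : ℝ} (hc0 : 0 < c) (hc : 4 * (1 / γA) ≤ c ^ 2)
    (a : Coef d) {I : Finset (B1Eq324BenfattoLemma.Site d)} (hI : I.Nonempty) :
    Real.exp (-((I.card : ℝ) * (4 * 8 ^ d * Real.exp (-(c ^ 2 / (2 * (1 / γA))))))) ≤
      ∫ z, cutoffBoltzmann (hamiltonian s D κ a (∅ : Finset (B1Eq324BenfattoLemma.Site d))) I c z ∂gaussianFieldOfKernel K :=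
  integral_cutoffBoltzmann_empty_ge_of_kernel (isPosSemidefKernel_kernel hK (posDef_of_coercive hAs hγA0 hγA))
    (one_div_pos.mpr hγA0) (kernel_self_le_inv hK hAs hγA0 hγA) hc0 hc a hI

omit hK in
/-- **APPENDIX A FOR THE TERMINAL INTEGRAL OF THE CLASS, uniform `∃ b̄ k₁ k₂`**: for every `γ_A > 0` there are `b̄, k₁ ≥ 0, k₂ > 0` depending on
`(d, γ_A)` only such that for EVERY finite `Λ`, every symmetric `γ_A`-coercive `A` on `Λ`, its class kernel `K`, every `c > b̄` and every nonempty `I`: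
`exp(−|I|·k₁e^{−k₂c²}) ≤ ∫ cutoffBoltzmann (hamiltonian s D ϰ a ∅) I c dμ_K` — the `(b̄, k₁, k₂)`-currency of the concrete chain's socket
(`…Sect5Termination.exists_integral_cutoffBoltzmann_empty_ge`, `…Sect5BasicLemmaKnit.basicLemma_signed_of_ledgers`), for the class.
[cite: BenfattoEtAl1978, Appendix A (A.1)–(A.2) p.161; §5 p.154, p.159; Balaban1985BackgroundPropagators, Sect. E p.428] -/
theorem exists_integral_cutoffBoltzmann_empty_ge_of_class (d : ℕ) {γA : ℝ} (hγA0 : 0 < γA) :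
    ∃ bbar k₁ k₂ : ℝ, 0 ≤ k₁ ∧ 0 < k₂ ∧
      ∀ {Λ : Finset (B1Eq324BenfattoLemma.Site d)} {A : Matrix Λ Λ ℝ}
        {K : B1Eq324BenfattoLemma.Site d → B1Eq324BenfattoLemma.Site d → ℝ},
        (∀ x y, K x y = if h : x ∈ Λ ∧ y ∈ Λ then (A⁻¹ : Matrix Λ Λ ℝ) ⟨x, h.1⟩ ⟨y, h.2⟩ else 0) →
        (∀ e e', A e e' = A e' e) → (∀ v : Λ → ℝ, γA * ∑ e, v e ^ 2 ≤ ∑ e, ∑ e', A e e' * v e * v e') →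
        ∀ {s D : ℕ} {κ : ℝ} (a : Coef d) (c : ℝ), bbar < c → ∀ I : Finset (B1Eq324BenfattoLemma.Site d), I.Nonempty →
          Real.exp (-((I.card : ℝ) * (k₁ * Real.exp (-(k₂ * c ^ 2))))) ≤
            ∫ z, cutoffBoltzmann (hamiltonian s D κ a (∅ : Finset (B1Eq324BenfattoLemma.Site d))) I c z ∂gaussianFieldOfKernel K := by
  obtain ⟨bbar, k₁, k₂, hk₁, hk₂, h⟩ := exists_integral_cutoffBoltzmann_empty_ge_of_kernel d (1 / γA)
  refine ⟨bbar, k₁, k₂, hk₁, hk₂, fun hK' hAs hγA _ _ _ a c hc I hI => ?_⟩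
  exact h (isPosSemidefKernel_kernel hK' (posDef_of_coercive hAs hγA0 hγA)) (kernel_self_le_inv hK' hAs hγA0 hγA) a c hc I hI

end ClassKernel

end Literature.MathematicalPhysics.QuantumFieldTheory.Balaban1983to89.B1Eq324BenfattoKernelSect5Termination
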